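import Mathlib
import HarnessLib
import Summits.ResolutionOfSingularities.ResolutionOfSingularities.Theorems.WildQuotientsWildQuotientResolutionS1aNpFrame
import Summits.ResolutionOfSingularities.ResolutionOfSingularities.Theorems.WildQuotientsWildQuotientResolutionS1aKillableTransport

/-!
# S1a — K-FREE FRAME, producer tools III: (F-T2) node data RESTRICT to invariant basic opens and TRANSFER along equivariant local isomorphisms; `PrincipalNear` is bookkeeping-invariant

[OURS · L1 W4.5c · lead-1 g11; plan-1 ASSIGNMENT v10.34 (F-T2), A-KF v0 (O3)/(B1)] — NOT statements of the manuscript; counted 0; AI-level work, weaker than expert review.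
Crux stmt-ResolutionOfSingularities-17941 `CyclicQuotientFourfolds`, line `s1a-logminvertex` v12 (`stub_reachLowerInF`). Route-independent.

The re-decoration of a realisation `π′ : M′ → M` of a named centre (A-KF v0 (O3)) carries every old chart `(O, D)` of the atlas, restricted to the invariant basic
opens `D(b) ⊆ O ∖ supp`, across the isomorphism `π′ : π′⁻¹ D(b) ≅ D(b)`. This file provides the two operations on node DATA and proves that «principal near u»
is invariant under both (bookkeeping lemma B1), in the common normal form
  `KilledAway D x` := «the augmentation ideal of the node ring becomes principal after inverting `x`».
* `NodeData.KilledAway`, `killedAway_mul` (monotone under further localisation), `killedAway_iff_of_away` (any `Away`-algebra computes it);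
* `NodeData.principalNear_iff_killedAway_mul` — `PrincipalNear D u` in terms of an invariant section `c` with `u ∈ D(c)`: for any fixed invariant `b` with `u ∈ D(b)`,
  `PrincipalNear D u ↔ ∃ c invariant, u ∈ D(c) ∧ KilledAway D (e b * e c)`;
* ★ `NodeData.restrict D hb` (node data on `basicOpenStable`, from `exists_nodeData_basicOpen`), `killedAway_restrict_algebraMap_iff`
  (`KilledAway` of the restriction at `c|_{D(b)}` = `KilledAway D (e b * e c)`), `killedAway_mul_unit_iff`; the remaining equivalence
  `(D.restrict hb).PrincipalNear u ↔ D.PrincipalNear u` (normalise a section of `D(b)` into the image of `Γ(V, O)`) follows in the companion file;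
* ★ `NodeData.transfer` (node data on `π′⁻¹ O` along an equivariant `π′` that is an isomorphism over `O`, pattern of `isPrincipalCentreChart_preimage`) and
  ★ `principalNear_transfer_iff` : `(D.transfer …).PrincipalNear v′ ↔ D.PrincipalNear (π′ v′)`.
-/

set_option linter.dupNamespace false

noncomputable section

universe u

open CategoryTheory Limits AlgebraicGeometry TopologicalSpace Topology
open Literature.AlgebraicGeometry.Resolution Literature.AlgebraicGeometry.RelativeSpec
open Summit.ResolutionOfSingularities.ResolutionOfSingularities.Theorems.WildQuotientResolution.S1
open Summit.ResolutionOfSingularities.ResolutionOfSingularities.Theorems.WildQuotientResolution.S1.NodeAtlas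
open Summit.ResolutionOfSingularities.ResolutionOfSingularities.Theorems.WildQuotientResolution.S1.GoodCharts
open Summit.ResolutionOfSingularities.ResolutionOfSingularities.Theorems.WildQuotientResolution.S1.NodeChartAway
open Summit.ResolutionOfSingularities.ResolutionOfSingularities.Theorems.WildQuotientResolution.S1.NodeAway
open Summit.ResolutionOfSingularities.ResolutionOfSingularities.Theorems.WildQuotientResolution.S1.GradedLocalization
open Summit.ResolutionOfSingularities.ResolutionOfSingularities.Theorems.WildQuotientResolution.S1.KillableTransport
open Summit.ResolutionOfSingularities.ResolutionOfSingularities.Theorems.WildQuotientResolution.S1.BlowupCharts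

namespace Summit.ResolutionOfSingularities.ResolutionOfSingularities.Theorems.WildQuotientResolution.S1.NpFrame

namespace NodeData

variable {p : ℕ} {V Y : Scheme.{u}} {q : V ⟶ Y} {G : Type u} [Group G] {ρ : ActionOver q G} {g₀ : G}
  {O : ρ.StableAffineOpens} (D : NodeData p ρ g₀ O)

/-! ## `KilledAway`: the augmentation ideal becomes principal after inverting `x` -/

/-- The augmentation ideal of the node ring becomes principal after inverting `x ∈ B`. -/
def KilledAway (x : D.B) : Prop :=
  letI := D.instCommRing
  ((augmentationIdeal D.σ).map (algebraMap D.B (Localization.Away x))).IsPrincipal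

/-- `KilledAway` may be tested in ANY `Away x`-algebra. -/
theorem killedAway_iff_of_away (x : D.B) (S : Type u) [CommRing S] [letI := D.instCommRing; Algebra D.B S]
    [letI := D.instCommRing; IsLocalization.Away x S] :
    letI := D.instCommRing
    D.KilledAway x ↔ ((augmentationIdeal D.σ).map (algebraMap D.B S)).IsPrincipal := by
  letI := D.instCommRing
  let ε : Localization.Away x ≃ₐ[D.B] S := IsLocalization.algEquiv (Submonoid.powers x) _ _
  have hcomp : (ε : Localization.Away x →+* S).comp (algebraMap D.B (Localization.Away x)) = algebraMap D.B S :=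
    RingHom.ext fun b => ε.commutes b
  constructor
  · rintro ⟨⟨g, hg⟩⟩
    refine ⟨⟨ε g, ?_⟩⟩
    rw [← hcomp, ← Ideal.map_map, Ideal.submodule_span_eq, hg, Ideal.submodule_span_eq, Ideal.map_span, Set.image_singleton]
    rfl
  · rintro ⟨⟨g, hg⟩⟩
    refine ⟨⟨ε.symm g, ?_⟩⟩
    have hcomp' : ((ε.symm : S ≃ₐ[D.B] Localization.Away x) : S →+* Localization.Away x).comp (algebraMap D.B S) =
        algebraMap D.B (Localization.Away x) := RingHom.ext fun b => ε.symm.commutes b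
    rw [← hcomp', ← Ideal.map_map, Ideal.submodule_span_eq, hg, Ideal.submodule_span_eq, Ideal.map_span, Set.image_singleton]
    rfl

/-- **Monotonicity**: killed after inverting `x` ⇒ killed after inverting `x * y`. -/
theorem killedAway_mul {x : D.B} (h : D.KilledAway x) (y : D.B) : letI := D.instCommRing; D.KilledAway (x * y) := by
  letI := D.instCommRing
  obtain ⟨⟨g, hg⟩⟩ := h
  let φ : Localization.Away x →+* Localization.Away (x * y) := IsLocalization.Away.awayToAwayRight x y
  have hcomp : φ.comp (algebraMap D.B (Localization.Away x)) = algebraMap D.B (Localization.Away (x * y)) :=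
    RingHom.ext fun b => IsLocalization.Away.awayToAwayRight_eq x y b
  refine ⟨⟨φ g, ?_⟩⟩
  rw [← hcomp, ← Ideal.map_map, Ideal.submodule_span_eq, hg, Ideal.submodule_span_eq, Ideal.map_span, Set.image_singleton]

/-- `KilledAway` is symmetric in the factors. -/
theorem killedAway_mul_comm {x y : D.B} (h : letI := D.instCommRing; D.KilledAway (x * y)) : letI := D.instCommRing; D.KilledAway (y * x) := by
  letI := D.instCommRing
  rwa [mul_comm]

/-! ## `PrincipalNear` in normal form -/

/-- `PrincipalNear D u` unfolds to an invariant section `c` with `u ∈ D(c)` and `KilledAway D (e c)`. -/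
theorem principalNear_iff (u : V) :
    D.PrincipalNear u ↔ ∃ c : Γ(V, O.1), (∀ g : G, actO ρ O g c = c) ∧ u ∈ V.basicOpen c ∧ D.KilledAway ((D.e c : ↥(D.𝒜 0)) : D.B) :=
  Iff.rfl

/-- ★ **Normal form relative to a fixed invariant section `b` with `u ∈ D(b)`**: `PrincipalNear D u ↔ ∃ c` invariant with `u ∈ D(c)` and the node killed
after inverting `e b * e c`. [OURS · L1 W4.5c · B1] -/
theorem principalNear_iff_killedAway_mul {b : Γ(V, O.1)} (hb : ∀ g : G, actO ρ O g b = b) {u : V} (hub : u ∈ V.basicOpen b) :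
    D.PrincipalNear u ↔ ∃ c : Γ(V, O.1), (∀ g : G, actO ρ O g c = c) ∧ u ∈ V.basicOpen c ∧
      (letI := D.instCommRing; D.KilledAway (((D.e b : ↥(D.𝒜 0)) : D.B) * ((D.e c : ↥(D.𝒜 0)) : D.B))) := by
  letI := D.instCommRing
  letI := D.instGradedRing
  constructor
  · rintro ⟨c, hc, huc, hk⟩
    exact ⟨c, hc, huc, D.killedAway_mul_comm (D.killedAway_mul hk _)⟩
  · rintro ⟨c, hc, huc, hk⟩
    refine ⟨b * c, fun g => by rw [map_mul, hb, hc], ?_, ?_⟩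
    · rw [Scheme.basicOpen_mul]; exact ⟨hub, huc⟩
    · have : ((D.e (b * c) : ↥(D.𝒜 0)) : D.B) = ((D.e b : ↥(D.𝒜 0)) : D.B) * ((D.e c : ↥(D.𝒜 0)) : D.B) := by
        rw [map_mul]; rfl
      rw [this]; exact hk

/-! ## Restriction of node data to an invariant basic open -/

section Restrict

variable {b : Γ(V, O.1)} (hb : ∀ g : G, actO ρ O g b = b)

/-- `σ` fixes `e b` for an invariant section `b`. -/
theorem sigma_e_eq_of_invariant (hb : ∀ g : G, actO ρ O g b = b) :
    letI := D.instCommRing; letI := D.instGradedRing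
    D.σ ((D.e b : ↥(D.𝒜 0)) : D.B) = (D.e b : ↥(D.𝒜 0)) := by
  letI := D.instCommRing; letI := D.instGradedRing
  rw [← D.intertwine b, hb g₀]

/-- ★ **Restriction of node data to the invariant basic open `D(b)`**: the localised node `(B[(e b)⁻¹], locPiece, σ_{e b})` with the identification
`basicOpenNodeEquiv` (the data of `exists_nodeData_basicOpen`). [OURS · L1 W4.5c · (F-T2)] -/
def restrict : NodeData p ρ g₀ (basicOpenStable ρ O D.affine hb) :=
  letI := D.instCommRing; letI := D.instGradedRing
  { affine := isAffineOpen_basicOpenStable ρ O D.affine hb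
    m := D.m
    r := D.r
    B := Localization.Away ((D.e b : ↥(D.𝒜 0)) : D.B)
    instCommRing := inferInstance
    𝒜 := locPiece D.𝒜 (D.e b).2
    instGradedRing := locGradedRing D.𝒜 (D.e b).2
    σ := sigmaAway D.σ (D.sigma_e_eq_of_invariant hb)
    e := basicOpenNodeEquiv ρ O D.affine b D.𝒜 D.e
    tame := (exists_nodeData_basicOpen ρ O D.affine hb D.𝒜 D.e g₀ D.σ D.tame D.intertwine).choose_spec.1
    intertwine := (exists_nodeData_basicOpen ρ O D.affine hb D.𝒜 D.e g₀ D.σ D.tame D.intertwine).choose_spec.2.1 }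

/-- The node ring of the restriction. -/
theorem restrict_B : (D.restrict hb).B = (letI := D.instCommRing; Localization.Away ((D.e b : ↥(D.𝒜 0)) : D.B)) := rfl

/-- `KilledAway` for the restriction at the image of a section `c` of `O` = `KilledAway D (e b * e c)`. -/
theorem killedAway_restrict_algebraMap_iff (c : Γ(V, O.1)) :
    (D.restrict hb).KilledAway (((D.restrict hb).e (algebraMap Γ(V, O.1) Γ(V, V.basicOpen b) c) : ↥((D.restrict hb).𝒜 0)) : (D.restrict hb).B) ↔
      (letI := D.instCommRing; D.KilledAway (((D.e b : ↥(D.𝒜 0)) : D.B) * ((D.e c : ↥(D.𝒜 0)) : D.B))) := by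
  letI := D.instCommRing; letI := D.instGradedRing
  letI := locGradedRing D.𝒜 (D.e b).2
  -- the element is `(e c)/1`
  have hec : (((D.restrict hb).e (algebraMap Γ(V, O.1) Γ(V, V.basicOpen b) c) : ↥((D.restrict hb).𝒜 0)) : (D.restrict hb).B) =
      algebraMap D.B (Localization.Away ((D.e b : ↥(D.𝒜 0)) : D.B)) ((D.e c : ↥(D.𝒜 0)) : D.B) :=
    coe_basicOpenNodeEquiv_map ρ O D.affine (b := b) D.𝒜 D.e c
  rw [hec]
  -- both sides are «principal in an `Away (e b * e c)`-algebra»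
  let S := Localization.Away ((D.e b : ↥(D.𝒜 0)) : D.B)
  let T := Localization.Away (algebraMap D.B S ((D.e c : ↥(D.𝒜 0)) : D.B))
  have h1 : (D.restrict hb).KilledAway (algebraMap D.B S ((D.e c : ↥(D.𝒜 0)) : D.B)) ↔
      ((augmentationIdeal D.σ).map (algebraMap D.B T)).IsPrincipal := by
    change ((augmentationIdeal (sigmaAway D.σ (D.sigma_e_eq_of_invariant hb))).map (algebraMap S T)).IsPrincipal ↔ _
    rw [augmentationIdeal_sigmaAway, Ideal.map_map, ← IsScalarTower.algebraMap_eq]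
  rw [h1]
  exact (D.killedAway_iff_of_away (((D.e b : ↥(D.𝒜 0)) : D.B) * ((D.e c : ↥(D.𝒜 0)) : D.B)) T).symm

/-- Sections of `D(b)` that are units do not change a basic open / a localisation: `KilledAway` at `x` and at `x * u` for a unit `u` agree. -/
theorem killedAway_mul_unit_iff (D' : NodeData p ρ g₀ O) (x y : D'.B) (hy : letI := D'.instCommRing; IsUnit y) :
    (letI := D'.instCommRing; D'.KilledAway (x * y)) ↔ D'.KilledAway x := by
  letI := D'.instCommRing
  -- `Away (x * y)` is an `Away x`-algebra when `y` is a unit: use `Localization.Away x` itself as an `Away (x*y)` algebra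
  haveI : IsLocalization.Away (x * y) (Localization.Away x) :=
    IsLocalization.Away.of_associated (r := x) ⟨hy.unit, by rw [IsUnit.unit_spec]⟩
  exact D'.killedAway_iff_of_away (x * y) (Localization.Away x)

end Restrict

end NodeData

/-! ## Transfer of node data along an equivariant morphism that is an isomorphism over the chart -/

namespace NodeData

variable {p : ℕ} {V' V Y : Scheme.{u}} {q : V ⟶ Y} {r' : V' ⟶ Y} {G : Type u} [Group G] (ρ : ActionOver q G) (ρ' : ActionOver r' G)
  (π' : V' ⟶ V) (hr' : r' = π' ≫ q) (hcomm : ∀ g : G, (ρ'.aut g).hom ≫ π' = π' ≫ (ρ.aut g).hom) {g₀ : G}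

include hr' in
/-- The preimage chart is affine over the base (when `π′` is an isomorphism over the chart). -/
theorem isAffineHom_preimage_ι (O : ρ.StableAffineOpens) [IsIso (π' ∣_ O.1)] : IsAffineHom ((π' ⁻¹ᵁ O.1).ι ≫ r') := by
  rw [hr', ← Category.assoc, ← morphismRestrict_ι, Category.assoc]
  haveI := O.2.2
  infer_instance

/-- The preimage of an affine chart over which `π′` is an isomorphism is affine. -/
theorem isAffineOpen_preimage (O : ρ.StableAffineOpens) (hO : IsAffineOpen O.1) [h : IsIso (π' ∣_ O.1)] : IsAffineOpen (π' ⁻¹ᵁ O.1) := by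
  haveI : IsAffine (O.1 : Scheme.{u}) := hO
  exact @IsAffine.of_isIso _ _ (π' ∣_ O.1) h inferInstance

/-- **The preimage of a stable open affine over the base** (as a stable open affine over the base of `V'`). -/
def preimageStable (O : ρ.StableAffineOpens) [IsIso (π' ∣_ O.1)] : ρ'.StableAffineOpens :=
  ⟨π' ⁻¹ᵁ O.1, preimage_stable ρ ρ' π' hcomm O.1 O.2.1, isAffineHom_preimage_ι ρ π' hr' O⟩

/-- Its underlying open. -/
@[simp] theorem preimageStable_val (O : ρ.StableAffineOpens) [IsIso (π' ∣_ O.1)] : (preimageStable ρ ρ' π' hr' hcomm O).1 = π' ⁻¹ᵁ O.1 := rfl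

/-- The sections isomorphism `Γ(V, O) ≃ Γ(V', π′⁻¹ O)` when `π′` is an isomorphism over `O`. -/
def sectionsEquiv (O : ρ.StableAffineOpens) [IsIso (π' ∣_ O.1)] : Γ(V, O.1) ≃+* Γ(V', π' ⁻¹ᵁ O.1) :=
  haveI : IsIso (π'.appLE O.1 (π' ⁻¹ᵁ O.1) le_rfl) := isIso_app_of_isIso_morphismRestrict O.1 inferInstance
  (asIso (π'.appLE O.1 (π' ⁻¹ᵁ O.1) le_rfl)).commRingCatIsoToRingEquiv

/-- Pin: the sections isomorphism is `π′.appLE`. -/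
theorem sectionsEquiv_apply (O : ρ.StableAffineOpens) [IsIso (π' ∣_ O.1)] (s : Γ(V, O.1)) :
    sectionsEquiv ρ π' O s = π'.appLE O.1 (π' ⁻¹ᵁ O.1) le_rfl s := rfl

include hcomm in
/-- The sections isomorphism intertwines the actions. -/
theorem actO_sectionsEquiv (O : ρ.StableAffineOpens) [IsIso (π' ∣_ O.1)] (g : G) (s : Γ(V, O.1)) :
    actO ρ' (preimageStable ρ ρ' π' hr' hcomm O) g (sectionsEquiv ρ π' O s) = sectionsEquiv ρ π' O (actO ρ O g s) := by
  rw [sectionsEquiv_apply, sectionsEquiv_apply]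
  exact appLE_comm_of_le ρ ρ' hcomm O.1 O.2.1 (π' ⁻¹ᵁ O.1) (preimage_stable ρ ρ' π' hcomm O.1 O.2.1) le_rfl g⁻¹ s

/-- ★ **TRANSFER of node data along an equivariant morphism that is an isomorphism over the chart** (same node ring, grading and `σ`;
`e′ := e ∘ (sections iso)⁻¹`; pattern of `isPrincipalCentreChart_preimage`). [OURS · L1 W4.5c · (F-T2)] -/
def transfer {O : ρ.StableAffineOpens} (D : NodeData p ρ g₀ O) [IsIso (π' ∣_ O.1)] : NodeData p ρ' g₀ (preimageStable ρ ρ' π' hr' hcomm O) :=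
  letI := D.instCommRing; letI := D.instGradedRing
  { affine := isAffineOpen_preimage ρ π' O D.affine
    m := D.m
    r := D.r
    B := D.B
    instCommRing := D.instCommRing
    𝒜 := D.𝒜
    instGradedRing := D.instGradedRing
    σ := D.σ
    e := (sectionsEquiv ρ π' O).symm.trans D.e
    tame := D.tame
    intertwine := fun t => by
      obtain ⟨s, rfl⟩ := (sectionsEquiv ρ π' O).surjective t
      change ((D.e ((sectionsEquiv ρ π' O).symm (actO ρ' (preimageStable ρ ρ' π' hr' hcomm O) g₀ (sectionsEquiv ρ π' O s))) : ↥(D.𝒜 0)) : D.B) =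
        D.σ ((D.e ((sectionsEquiv ρ π' O).symm (sectionsEquiv ρ π' O s)) : ↥(D.𝒜 0)) : D.B)
      rw [actO_sectionsEquiv ρ ρ' π' hr' hcomm, RingEquiv.symm_apply_apply, RingEquiv.symm_apply_apply]
      exact D.intertwine s }

/-- `KilledAway` is unchanged by transfer (same node ring). -/
theorem killedAway_transfer_iff {O : ρ.StableAffineOpens} (D : NodeData p ρ g₀ O) [IsIso (π' ∣_ O.1)] (x : D.B) :
    (D.transfer ρ ρ' π' hr' hcomm).KilledAway x ↔ D.KilledAway x := Iff.rfl

/-- ★ **`PrincipalNear` is invariant under transfer** (bookkeeping lemma B1, transfer half): `(D.transfer …).PrincipalNear v′ ↔ D.PrincipalNear (π′ v′)`.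
[OURS · L1 W4.5c · (F-T2)] -/
theorem principalNear_transfer_iff {O : ρ.StableAffineOpens} (D : NodeData p ρ g₀ O) [IsIso (π' ∣_ O.1)] (v' : V') :
    (D.transfer ρ ρ' π' hr' hcomm).PrincipalNear v' ↔ D.PrincipalNear (π'.base v') := by
  letI := D.instCommRing; letI := D.instGradedRing
  let P := sectionsEquiv ρ π' O
  -- basic opens correspond
  have hbo : ∀ c : Γ(V, O.1), V'.basicOpen (P c) = π' ⁻¹ᵁ V.basicOpen c := by
    intro c
    rw [show P c = π'.appLE O.1 (π' ⁻¹ᵁ O.1) le_rfl c from rfl, Scheme.Hom.appLE, CommRingCat.comp_apply, Scheme.basicOpen_res,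
      ← Scheme.preimage_basicOpen]
    exact inf_eq_right.mpr (π'.preimage_mono (V.basicOpen_le c))
  rw [principalNear_iff, principalNear_iff]
  constructor
  · rintro ⟨c', hc', hu', hk'⟩
    obtain ⟨c, rfl⟩ := P.surjective c'
    refine ⟨c, fun g => P.injective ?_, ?_, ?_⟩
    · rw [← actO_sectionsEquiv ρ ρ' π' hr' hcomm]; exact hc' g
    · have : v' ∈ π' ⁻¹ᵁ V.basicOpen c := by rw [← hbo]; exact hu'
      exact this
    · have he : (((D.transfer ρ ρ' π' hr' hcomm).e (P c) : ↥((D.transfer ρ ρ' π' hr' hcomm).𝒜 0)) : (D.transfer ρ ρ' π' hr' hcomm).B) =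
          ((D.e c : ↥(D.𝒜 0)) : D.B) := by
        change ((D.e (P.symm (P c)) : ↥(D.𝒜 0)) : D.B) = _
        rw [RingEquiv.symm_apply_apply]
      rw [he] at hk'
      exact hk'
  · rintro ⟨c, hc, hu, hk⟩
    refine ⟨P c, fun g => ?_, ?_, ?_⟩
    · rw [actO_sectionsEquiv ρ ρ' π' hr' hcomm, hc g]
    · show v' ∈ V'.basicOpen (P c)
      rw [hbo]; exact hu
    · have he : (((D.transfer ρ ρ' π' hr' hcomm).e (P c) : ↥((D.transfer ρ ρ' π' hr' hcomm).𝒜 0)) : (D.transfer ρ ρ' π' hr' hcomm).B) =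
          ((D.e c : ↥(D.𝒜 0)) : D.B) := by
        change ((D.e (P.symm (P c)) : ↥(D.𝒜 0)) : D.B) = _
        rw [RingEquiv.symm_apply_apply]
      show (D.transfer ρ ρ' π' hr' hcomm).KilledAway _
      rw [he]
      exact hk

end NodeData

end Summit.ResolutionOfSingularities.ResolutionOfSingularities.Theorems.WildQuotientResolution.S1.NpFrame

end
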